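import Summits.HodgeConjecture.CorCM.Hyp413.A3Liu413FaceTypes
import Summits.HodgeConjecture.HodgeConjecture.Theorems.H413CohFormsCarriersLemmas
import Summits.HodgeConjecture.HodgeConjecture.Theorems.P4StubT1ArchFactor
import HarnessLib

/-!
# FLOOR-0 P3, stub S1 — PLAN PIN: «P4's class map `cls` bijective ⇒ S1's `dec`» (report-first statement file of seat F0P3-p01)

Cell hodgecm-mathlib (D-0151), FLOOR 0, crux item H413 = stmt-HodgeConjecture-24833; programme P3 «U3-mult», line
`Cruxes/H413/Lines/F0_U3CohMultOne.lean` v1.1 (cf02d769), stub `stub_S1_hodgeMatsushimaDecAt : StubS1HodgeMatsushimaDecAt` (M–L, «B4 desk»,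
JOIN-BRIEF §3 p01).  Author F0P3-p01 (g0).  `--supports stmt-HodgeConjecture-24833 --as helper`.

WHAT THIS FILE PINS (the lead's «ONE theorem `cls` is an equivariant bijection ⇒ `dec := cls⁻¹`»): the EXACT relation between P4's node
`StubT2MatsushimaHodgeAt` (`Lines/F0_P4AdmissibleOccursInH1.lean` :155–164: an injective `cls : ↥(cohForms 𝔞₀) →ₗ[ℂ] H¹_{B,τ'}` with
`cls ⟨R_g f, _⟩ = rhoB τ' g (cls f)`) and P3's S1 (an injective `dec : H¹_{B,τ'} →ₗ[ℂ] (U(V)(𝔸_{F⁺}) → ℂ²)` with values in `cohForms 𝔞₀` and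
`dec (rhoB τ' g x) = R_g (dec x)`).  The two ACTION DIRECTIONS AGREE: if `cls` is moreover SURJECTIVE, `dec := (cohForms 𝔞₀).subtype ∘ cls⁻¹`
satisfies S1 — the side condition `hgf : R_g f ∈ cohForms 𝔞₀` that T2's equivariance clause quantifies over is FED by the carriers' stability
★ `ArchFactor.IsHonest.rightRep_mem_cohForms` at ★ `archFactorOf_isHonest` (A-p13 (g21), `Theorems/H413CohFormsCarriersLemmas`,
`Theorems/P4StubT1ArchFactor`).  Kernel-checked:

* §1 `exists_dec_of_bijective` — generic linear algebra over any field: a stable submodule `S ≤ X` of a representation `R`, any family of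
  endomorphisms `σ g` of `H`, and a BIJECTIVE `cls : S →ₗ H` with `cls ⟨R g f, _⟩ = σ g (cls f)` give `dec : H →ₗ X` injective, `S`-valued,
  with `dec (σ g x) = R g (dec x)`;
* §2 `stubS1_of_cls_bijective` — AT THE PIN: «for every face, `3 ≤ n`, every `τ'`, a bijective `cls` with T2's clause» ⇒ the body of
  `StubS1HodgeMatsushimaDecAt` VERBATIM (Theorems may not import `Cruxes/…/Lines`; token identity is for the referee).

The surjectivity of `cls` (= every tower class is the class of a `(1,0) ⊕ (0,1)` cotangent form: Hodge decomposition levelwise + gluing of the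
harmonic pull-backs into an adelic form) is NOT claimed here; it is the content of the seat's next files (`F0P3TowerGlue`, `F0P3StubS1Dec`), which
construct `dec` DIRECTLY.  HC_CM is proved only modulo the printed citations until rung 0 closes; this file proves nothing about them.
[cite: BorelWallach2000, VII 3.2; XIII 1.2] [cite: BorelJacquet1979, §4.2]

## References
* [BorelWallach2000] A. Borel, N. Wallach, *Continuous cohomology, discrete subgroups, and representations of reductive groups*, 2nd ed., AMS 2000,
  VII 3.2 (Matsushima's formula), XIII 1.2 (adelic pieces).
* [BorelJacquet1979] A. Borel, H. Jacquet, Corvallis PSPM 33.1, §4.2 (right translation on automorphic forms).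
* Tree: ★ `CorCM/Hyp413/A3Liu413FaceTypes` (`datum413`), ★ `Theorems/H413CohFormsCarriers` (`cohForms`, `rightRep`, `archFactorOf`), ★
  `Theorems/H413CohFormsCarriersLemmas` (`IsHonest.rightRep_mem_cohForms`), ★ `Theorems/P4StubT1ArchFactor` (`archFactorOf_isHonest`).
-/

set_option autoImplicit false
set_option linter.dupNamespace false

noncomputable section

open NumberField NumberField.InfinitePlace
open HodgeCM HodgeCM.Model HodgeCM.Model.LiuIndex
open Summit.HodgeConjecture.CorCM.Model
open Literature.AlgebraicGeometry.Motives (CMType)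
open Literature.NumberTheory.ComplexMultiplication
open Literature.NumberTheory.Automorphic
open Literature.NumberTheory.Automorphic.Liu2021 Literature.NumberTheory.Automorphic.Liu2021.AppendixC
open Literature.NumberTheory.GelbartRogawski1991
open Summit.HodgeConjecture.CorCM Summit.HodgeConjecture.CorCM.Transposition
open Summit.HodgeConjecture.CorCM.Lines.A3Liu413 (datum413)
open Summit.HodgeConjecture.HodgeConjecture.Cruxes.H413.CohFormsCarriers

namespace Summit.HodgeConjecture.HodgeConjecture.Cruxes.H413.F0P3S1Plan

/-! ## §1 Generic: inverting a bijective equivariant map defined on a stable submodule -/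

section Generic

variable {k : Type*} [Field k] {G : Type*} [Monoid G]
variable {X H : Type*} [AddCommGroup X] [Module k X] [AddCommGroup H] [Module k H]

/-- **Inverting a bijective equivariant class map.**  `R` a representation on `X`, `S ≤ X` an `R`-stable submodule, `σ g` endomorphisms of `H`,
`cls : S → H` linear, BIJECTIVE, with `cls (R g f) = σ g (cls f)`; then `dec := S.subtype ∘ cls⁻¹ : H → X` is injective, `S`-valued and
intertwines `σ g` with `R g`. [folklore] -/
theorem exists_dec_of_bijective (R : Representation k G X) (S : Submodule k X) (hS : ∀ (g : G) (x : X), x ∈ S → R g x ∈ S)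
    (σ : G → H →ₗ[k] H) (cls : ↥S →ₗ[k] H) (hbij : Function.Bijective cls)
    (heqv : ∀ (g : G) (f : ↥S) (hgf : R g (f : X) ∈ S), cls ⟨R g (f : X), hgf⟩ = σ g (cls f)) :
    ∃ dec : H →ₗ[k] X, Function.Injective dec ∧ (∀ x, dec x ∈ S) ∧ ∀ (g : G) (x : H), dec (σ g x) = R g (dec x) := by
  let e : ↥S ≃ₗ[k] H := LinearEquiv.ofBijective cls hbij
  have he : ∀ f : ↥S, e f = cls f := fun _ => rfl
  refine ⟨S.subtype ∘ₗ (e.symm : H →ₗ[k] ↥S), ?_, fun x => (e.symm x).2, fun g x => ?_⟩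
  · exact Subtype.val_injective.comp e.symm.injective
  · -- `x = cls f`, `σ g x = cls ⟨R g f, _⟩`
    obtain ⟨f, rfl⟩ := e.surjective x
    have h1 : σ g (e f) = e ⟨R g (f : X), hS g _ f.2⟩ := by rw [he, he, heqv]
    simp only [LinearMap.coe_comp, LinearEquiv.coe_coe, Function.comp_apply, Submodule.subtype_apply, h1,
      LinearEquiv.symm_apply_apply]

end Generic

/-! ## §2 At the pin: a bijective `cls` with P4-T2's clause gives S1 verbatim -/

set_option synthInstance.maxHeartbeats 400000 in
set_option maxHeartbeats 8000000 in
/-- **S1 ⟸ «P4's `cls` is a bijection»** — the conclusion is the body of `StubS1HodgeMatsushimaDecAt` (`Lines/F0_U3CohMultOne.lean` :163–171)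
VERBATIM; the hypothesis is P4's `StubT2MatsushimaHodgeAt` (:155–164) with `Function.Injective cls` strengthened to `Function.Bijective cls`.
The `hgf` of T2's clause is supplied by ★ `IsHonest.rightRep_mem_cohForms` at ★ `archFactorOf_isHonest`.
[cite: BorelWallach2000, VII 3.2; XIII 1.2] [cite: BorelJacquet1979, §4.2] -/
theorem stubS1_of_cls_bijective
    (hT2 : ∀ (hDel : Literature.AlgebraicGeometry.ShimuraVarieties.UnitaryCanonicalModel.canonicalModel_exists_printed)
      (F : HodgeCM.CMField) [IsGalois ℚ F] (h6 : 6 ≤ Module.finrank ℚ F) {ι₁ : F →+* ℂ} (V : HodgeCM.HermSpace3 F ι₁) (a₀ : RealScalar F)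
      (Φ : CMType F) (hΦ : ι₁ ∈ Φ.1) (i : (I V (repAt a₀) (muLiu ι₁ GramClass.rep))),
      3 ≤ (datum413 hDel F V a₀ Φ i).n → ∀ τ' : HodgeCM.CMField.K F →+* ℂ,
        ∃ cls : ↥(cohForms (archFactorOf F V)) →ₗ[ℂ] (datum413 hDel F V a₀ Φ i).HB τ',
          Function.Bijective cls ∧
            ∀ (g : ↥(HodgeCM.HermSpace3.adelicFin V)) (f : ↥(cohForms (archFactorOf F V)))
              (hgf : rightRep F V g (f : _) ∈ cohForms (archFactorOf F V)),
              cls ⟨rightRep F V g (f : _), hgf⟩ = (datum413 hDel F V a₀ Φ i).rhoB τ' g (cls f)) :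
    ∀ (hDel : Literature.AlgebraicGeometry.ShimuraVarieties.UnitaryCanonicalModel.canonicalModel_exists_printed)
      (F : HodgeCM.CMField) [IsGalois ℚ F] (h6 : 6 ≤ Module.finrank ℚ F) {ι₁ : F →+* ℂ} (V : HodgeCM.HermSpace3 F ι₁) (a₀ : RealScalar F)
      (Φ : CMType F) (hΦ : ι₁ ∈ Φ.1) (i : (I V (repAt a₀) (muLiu ι₁ GramClass.rep))),
      3 ≤ (datum413 hDel F V a₀ Φ i).n → ∀ τ' : HodgeCM.CMField.K F →+* ℂ,
        ∃ dec : (datum413 hDel F V a₀ Φ i).HB τ' →ₗ[ℂ] ((adelicDatum F V).Adelic → (Fin 2 → ℂ)),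
          Function.Injective dec ∧ (∀ x, dec x ∈ cohForms (archFactorOf F V)) ∧
            ∀ (g : ↥(HodgeCM.HermSpace3.adelicFin V)) (x : (datum413 hDel F V a₀ Φ i).HB τ'),
              dec ((datum413 hDel F V a₀ Φ i).rhoB τ' g x) = rightRep F V g (dec x) := by
  intro hDel F _ h6 ι₁ V a₀ Φ hΦ i hn τ'
  obtain ⟨cls, hbij, heqv⟩ := hT2 hDel F h6 V a₀ Φ hΦ i hn τ'
  exact exists_dec_of_bijective (rightRep F V) (cohForms (archFactorOf F V))
    (fun g x hx => (P4StubT1ArchFactor.archFactorOf_isHonest F V).rightRep_mem_cohForms hx g)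
    (fun g => ((datum413 hDel F V a₀ Φ i).rhoB τ' g : _ →ₗ[ℂ] _)) cls hbij heqv

end Summit.HodgeConjecture.HodgeConjecture.Cruxes.H413.F0P3S1Plan

end
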